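import Literature.NumberTheory.EllipticCurves.Smith2016.CongruentNumberRedeiDeterminant

/-!
# Smith 2016, Table 1 (Rédei), the row `n ≡ 2 (mod 4)`: `g(2d) ≡ det (A + D_z) (mod 2)` — PROVED

Topic `NumberTheory/EllipticCurves`, namespace `Literature.NumberTheory.EllipticCurves.Smith2016`.
A pure proof file (theorems only); no named fact, nothing asserted.  Companion of
`CongruentNumberRedeiDeterminant` (row `n ≡ 1 (mod 4)`) and `CongruentNumberRedeiCofactor` (row `n ≡ 3 (mod 4)`).

## The source

A. Smith, *The congruent numbers have positive natural density*, arXiv:1603.08479v2 (2016)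
[Smith2016CongruentDensity], §2, Table 1 ("Rédei matrices for four torsion of class groups of `ℚ√−n`";
absent from the held text layer, read from the arXiv source `cnc.tex` l. 22–34, transcribed in the cell's
`lit/SMITH2016-VERBATIM-SHEET.md` §2), row `n ≡ 2 (mod 4)`: "`g(n) = det (A + D_z)`", where for even `n`
"`A`, `y`, `z` come from the odd part `p₁⋯p_r` of `n`".  That is: for `d = p₁⋯p_k` odd square-free,
`g(2d) = #2Cl(ℚ(√−2d))` is odd iff `det (A + D_z) = 1` over `𝔽₂` (`A` Monsky's matrix of `d`,
`zᵢ = (2/pᵢ)₊`).  It is used in §2.2 for row 2 of Thm. 2.2: "if `d | n` corresponds to `S` and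
`d ≡ 1 (4)`, then `det P(A, y, z)[S] = g(2d)`" (chunk p0010 L1–L8).

## The proof (Rédei–Reichardt, a tree theorem, + linear algebra over `𝔽₂`)

The discriminant of `K = ℚ(√−2d)` is `−8d`, with prime tuple `(2; p₁, …, p_k)` and prime discriminants
`(±8; p₁*, …, p_k*)`.  By Rédei–Reichardt (`redeiReichardt_fourTwoCard_classGroup_holds`, Li–Ma 2008
Thm. 0.4) and `odd_genusClassNumber_iff_of_redeiReichardt`, `g(2d)` is odd iff `RM(−8d)` has rank `k`.
Its rows sum to zero, so its rank is that of the `(k+1) × k` matrix of its odd-prime columns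
(`rank_redeiMatrix_eq_rank_submatrix_succ`, from the row-`1` file), whose entries are
`RM_{2, p_b} = [(2/p_b) = −1] = z_b`, `RM_{p_a, p_b} = [(p_a/p_b) = −1] = A_{ba}` (`a ≠ b`) and
`RM_{p_b, p_b} = [((2d/p_b)/p_b) = −1] = z_b + A_{bb}`; i.e. it is `(z | (A + D_z))ᵀ`
(`redeiMatrix_cons_two_apply_succ_even`).  The row `z` is the sum of the rows of `(A + D_z)ᵀ`
(`A·1 = 0`), so the rank is `rank (A + D_z)`, and over `𝔽₂` a square matrix has full rank iff its
determinant is `1`.  Main statements: `odd_genusClassNumber_two_mul_iff_det` (any `K ≅ ℚ(√−2d)`) and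
`odd_genusClassNumber_genusField_two_mul_iff_det` (the tree's `GenusField (2d)`).  NO hypothesis on
`d mod 4` (for `d ≡ 3 (mod 4)` the prime discriminant at `2` is `+8`, giving the same bits `(2/p_b)`).

Cell `bsd-monsky` (prover-B g19).  AI provenance: written by an AI assistant; no human has reviewed it.

## References

* [Smith2016CongruentDensity] A. Smith, arXiv:1603.08479v2 (2016), §2 Table 1 row n ≡ 2 (4) (source
  `cnc.tex` l. 22–34) and §2.2 (chunk p0009 L11 – p0010 L8, the matrix `P(A, y, z)` and `g(2d)`).
* [LiMa2008] Y. Li, L. Ma, Acta Arith. 134 (2008), Lemma 0.1 (`D₂ = ±8`), Def. 0.2, Thm. 0.4.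
* [HeathBrown1994SelmerCongruentII] Appendix by P. Monsky, typescript p. 39 L10–L26 (`A`, `D₂`).
-/

open scoped Classical

open Matrix Finset
open Literature.NumberTheory.EllipticCurves.HeathBrown1994
open Literature.NumberTheory.EllipticCurves.HeathBrown1994.Families (legendreMatrix_apply_of_ne legendreMatrix_apply_self)
open Literature.NumberTheory.EllipticCurves.MonskySelmerParity
open Literature.NumberTheory.QuadraticFields.RedeiReichardt
open Literature.NumberTheory.EllipticCurves.Tian2014 (IsQuadraticFieldOfSqrt)
open Literature.NumberTheory.EllipticCurves.TianYuanZhang2017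

namespace Literature.NumberTheory.EllipticCurves.Smith2016

/-! ## §1 The prime tuple `(2; p₁, …, p_k)` of the discriminant `−8d`, `d = p₁⋯p_k` odd -/

section Tuple

variable {k : ℕ} (p : Fin k → ℕ)

/-- `∏ (2; p₁, …, p_k) = 2d`. [cite: LiMa2008, Lemma 0.1 (p. 279: the primes of D = −8d)] -/
theorem prod_cons_two_eq : ∏ i, (Fin.cons 2 p : Fin (k + 1) → ℕ) i = 2 * ∏ i, p i := by
  rw [Fin.prod_univ_succ, Fin.cons_zero]
  simp only [Fin.cons_succ]

/-- The shape "`∏ pᵢ = if n % 4 = 1 then 2n else n`" of the Rédei–Reichardt fact for the EVEN `n = 2d`: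
`∏ (2; p) = n`. [cite: LiMa2008, Lemma 0.1 (p. 279: D = −4n for n ≢ 3 (mod 4))] -/
theorem prod_cons_two_even :
    ∏ i, (Fin.cons 2 p : Fin (k + 1) → ℕ) i =
      if (2 * ∏ i, p i) % 4 = 1 then 2 * (2 * ∏ i, p i) else 2 * ∏ i, p i := by
  rw [prod_cons_two_eq, if_neg (by omega)]

/-- `2d / p_b = ∏_{i ≠ b+1} (2; p)_i`. [cite: LiMa2008, Def. 0.2 (p. 279)] -/
theorem two_mul_prod_div_eq (hp : ∀ i, (p i).Prime) (b : Fin k) :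
    (2 * ∏ i, p i) / p b = ∏ i ∈ univ.erase b.succ, (Fin.cons 2 p : Fin (k + 1) → ℕ) i := by
  rw [← prod_cons_two_eq p, ← prod_div_eq_prod_erase (Fin.cons 2 p) (prime_cons_two p hp) b.succ,
    Fin.cons_succ]

/-- Splitting a sum over `(2; p)` minus the index `b+1`: `Σ_{i ≠ b+1} F((2;p)_i) = F(2) + Σ_{a ≠ b} F(p_a)`.
[cite: LiMa2008, Def. 0.2 (p. 279)] -/
theorem sum_erase_succ_cons_two {M : Type*} [AddCommGroup M] (F : ℕ → M) (b : Fin k) :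
    ∑ i ∈ univ.erase b.succ, F ((Fin.cons 2 p : Fin (k + 1) → ℕ) i) =
      F 2 + ∑ a ∈ univ.erase b, F (p a) := by
  rw [Finset.sum_erase_eq_sub (mem_univ _), Fin.sum_univ_succ, Fin.cons_zero, Fin.cons_succ,
    Finset.sum_erase_eq_sub (mem_univ _)]
  simp only [Fin.cons_succ]
  abel

/-- **The odd-prime columns of the Rédei matrix of `ℚ(√−2d)`, `d = p₁⋯p_k` odd**: for every row `j` of the
tuple `(2; p₁, …, p_k)`, `RM(−8d)_{j, p_b}` is `z_b = (2/p_b)₊` if `j` is the prime `2`, Monsky's `A_{ba}` if `j`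
is the prime `p_a ≠ p_b`, and `A_{bb} + z_b` on the diagonal (`[((2d/p_b)/p_b) = −1] = (2/p_b)₊ + Σ_{a ≠ b} (p_a/p_b)₊`).
[cite: LiMa2008, Def. 0.2 (p. 279)] [cite: Smith2016CongruentDensity, §2 Table 1 row n ≡ 2 (4) (the matrix A + D_z)] -/
theorem redeiMatrix_cons_two_apply_succ_even (hp : ∀ i, (p i).Prime) (hodd : ∀ i, Odd (p i))
    (hinj : Function.Injective p) (j : Fin (k + 1)) (b : Fin k) :
    redeiMatrix (2 * ∏ i, p i) (Fin.cons 2 p) j b.succ =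
      Fin.cases (addLegendreSym 2 (p b))
        (fun a => legendreMatrix p b a + if a = b then addLegendreSym 2 (p b) else 0) j := by
  have hq := prime_cons_two p hp
  have hqinj := injective_cons_two p hodd hinj
  have hqprod := prod_cons_two_even p
  have hp2 := ne_two_of_odd p hodd
  rw [redeiMatrix_transpose_apply hq hqinj hqprod (cons_two_succ_ne_two p hodd b) j]
  refine Fin.cases ?_ (fun a => ?_) j
  · -- the prime `2`: `[(2/p_b) = −1] = z_b`
    rw [if_neg (Fin.succ_ne_zero b).symm, Fin.cases_zero, Fin.cons_zero, Fin.cons_succ]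
    refine ite_jacobiSym_eq_addLegendreSym (jacobiSym_eq_one_or_neg_one_of_prime (hp b) ?_)
    rw [show ((2 : ℕ) : ℤ) = ((2 : ℕ) : ℤ) from rfl, Int.cast_natCast]
    exact natCast_zmod_ne_zero_of_prime_ne (hp b) Nat.prime_two (hp2 b).symm
  · rw [Fin.cases_succ, Fin.cons_succ]
    by_cases hab : a = b
    · -- the diagonal: `[((2d/p_b)/p_b) = −1] = z_b + Σ_{a ≠ b} (p_a/p_b)₊ = z_b + A_bb`
      subst hab
      rw [if_pos rfl, if_pos rfl, two_mul_prod_div_eq p hp a, legendreMatrix_apply_self]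
      have hf : ∀ i ∈ univ.erase a.succ, (((Fin.cons 2 p : Fin (k + 1) → ℕ) i : ℕ) : ZMod (p a)) ≠ 0 := by
        intro i hi
        refine natCast_zmod_ne_zero_of_prime_ne (hp a) (hq i) fun h => ?_
        have : (Fin.cons 2 p : Fin (k + 1) → ℕ) i = (Fin.cons 2 p : Fin (k + 1) → ℕ) a.succ := by
          rw [h, Fin.cons_succ]
        exact (ne_of_mem_erase hi) (hqinj this)
      obtain ⟨hval, hsum⟩ := addLegendreSym_prod_left (univ.erase a.succ) (Fin.cons 2 p) (hp a) hf
      rw [ite_jacobiSym_eq_addLegendreSym hval, hsum,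
        sum_erase_succ_cons_two p (fun n => addLegendreSym n (p a)) a, add_comm]
      congr 1
      exact Finset.sum_congr rfl fun i hi => by rw [legendreMatrix_apply_of_ne p (ne_of_mem_erase hi).symm]
    · rw [if_neg (fun h => hab (Fin.succ_inj.mp h)), Fin.cons_succ, legendreMatrix_apply_of_ne p (Ne.symm hab),
        if_neg hab, add_zero]
      refine ite_jacobiSym_eq_addLegendreSym (jacobiSym_eq_one_or_neg_one_of_prime (hp b) ?_)
      rw [Int.cast_natCast]
      exact natCast_zmod_ne_zero_of_prime_ne (hp b) (hp a) fun h => hab (hinj h)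

/-! ## §2 Ranks: `rank RM(−8d) = rank (z | A + D_z)ᵀ = rank (A + D_z)` -/

/-- **`rank RM(−8d) = rank (A + D_z)`** for odd `d = p₁⋯p_k`: the odd-prime columns of `RM(−8d)` form
`(z | (A + D_z))ᵀ`, and the row `z` is the sum of the rows of `(A + D_z)ᵀ` (`A·1 = 0`).
[cite: Smith2016CongruentDensity, §2 Table 1 row n ≡ 2 (4)] [cite: LiMa2008, Def. 0.2, Thm. 0.4] -/
theorem rank_redeiMatrix_cons_two_even_eq_rank (hp : ∀ i, (p i).Prime) (hodd : ∀ i, Odd (p i))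
    (hinj : Function.Injective p) :
    (redeiMatrix (2 * ∏ i, p i) (Fin.cons 2 p)).rank = (legendreMatrix p + legendreDiagonal p 2).rank := by
  rw [rank_redeiMatrix_eq_rank_submatrix_succ]
  set C := legendreMatrix p + legendreDiagonal p 2 with hC
  set Z := (redeiMatrix (2 * ∏ i, p i) (Fin.cons 2 p)).submatrix id Fin.succ with hZ
  have hZapply : ∀ j b, Z j b = Fin.cases (motive := fun _ => ZMod 2) (addLegendreSym 2 (p b))
      (fun a => C b a) j := by
    intro j b
    rw [hZ, submatrix_apply, id, redeiMatrix_cons_two_apply_succ_even p hp hodd hinj j b]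
    refine Fin.cases rfl (fun a => ?_) j
    rw [Fin.cases_succ, Fin.cases_succ, hC, Matrix.add_apply, legendreDiagonal, diagonal_apply]
    by_cases hab : a = b
    · subst hab; simp
    · rw [if_neg hab, if_neg (Ne.symm hab)]
  refine le_antisymm ?_ ?_
  · -- `Z = Q * Cᵀ` with `Q = (1ᵀ ; I)`: the row of `2` is the sum of the other rows
    let Q : Matrix (Fin (k + 1)) (Fin k) (ZMod 2) :=
      Matrix.of fun j a => Fin.cases (motive := fun _ => ZMod 2) (1 : ZMod 2) (fun c => if c = a then 1 else 0) j
    have hrow : ∀ b, ∑ a, C b a = addLegendreSym 2 (p b) := by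
      intro b
      have h1 := congr_fun (legendreMatrix_mulVec_one p) b
      have h2 := congr_fun (legendreDiagonal_mulVec_one p 2) b
      rw [mulVec, dotProduct, Pi.zero_apply] at h1
      rw [mulVec, dotProduct] at h2
      simp only [Pi.one_apply, mul_one] at h1 h2
      rw [hC]
      simp only [Matrix.add_apply, sum_add_distrib, h1, h2, zero_add]
    have hZQ : Z = Q * Cᵀ := by
      ext j b
      rw [Matrix.mul_apply, hZapply]
      refine Fin.cases ?_ (fun c => ?_) j
      · simp only [Fin.cases_zero, Matrix.of_apply, one_mul, transpose_apply, Q]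
        exact (hrow b).symm
      · simp only [Fin.cases_succ, Matrix.of_apply, transpose_apply, ite_mul, one_mul, zero_mul, Q]
        rw [Finset.sum_ite_eq univ c, if_pos (mem_univ c)]
    calc Z.rank = (Q * Cᵀ).rank := by rw [← hZQ]
      _ ≤ Cᵀ.rank := rank_mul_le_right _ _
      _ = C.rank := rank_transpose _
  · -- `Cᵀ` is the row-submatrix of `Z` on the odd primes
    have hCZ : Cᵀ = Z.submatrix Fin.succ id := by
      ext a b
      rw [submatrix_apply, id, hZapply, Fin.cases_succ, transpose_apply]
    calc C.rank = Cᵀ.rank := (rank_transpose _).symm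
      _ = (Z.submatrix Fin.succ id).rank := by rw [← hCZ]
      _ ≤ Z.rank := rank_submatrix_le _ _ _

end Tuple

/-! ## §3 Smith's Table 1, row `n ≡ 2 (mod 4)`: `g(2d)` odd `⟺ det (A + D_z) = 1` -/

section Genus

variable {k : ℕ} (p : Fin k → ℕ)

/-- **`g(2d) ≡ det (A + D_z) (mod 2)`** (Smith's Table 1 via Rédei–Reichardt, a tree theorem): for
`d = p₁⋯p_k` a product of distinct odd primes, any `K` with `[K : ℚ] = 2`, `−2d ∈ K²`, the genus class number
`#2Cl(K)` is odd iff `det (A + D_z) = 1` over `𝔽₂` (`A` Monsky's matrix of `d`, `D_z = D₂`).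
[cite: Smith2016CongruentDensity, §2 Table 1 row n ≡ 2 (4) ("g(n) = det (A + D_z)")] [cite: LiMa2008, Thm. 0.4 (Rédei–Reichardt)] -/
theorem odd_genusClassNumber_two_mul_iff_det (hp : ∀ i, (p i).Prime) (hodd : ∀ i, Odd (p i))
    (hinj : Function.Injective p) (K : Type) [Field K] [NumberField K]
    (hK : IsQuadraticFieldOfSqrt K (-((2 * ∏ i, p i : ℕ) : ℤ))) :
    Odd (genusClassNumber K) ↔ (legendreMatrix p + legendreDiagonal p 2).det = 1 := by
  rw [odd_genusClassNumber_iff_of_redeiReichardt redeiReichardt_fourTwoCard_classGroup_holds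
      (prime_cons_two p hp) (injective_cons_two p hodd hinj) (prod_cons_two_even p) K hK,
    det_eq_one_iff_rank_eq_card, Fintype.card_fin,
    ← rank_redeiMatrix_cons_two_even_eq_rank p hp hodd hinj]
  have hle := rank_redeiMatrix_le (2 * ∏ i, p i) (Fin.cons 2 p) (Nat.succ_pos k)
  omega

/-- **Smith's Table 1, row `n ≡ 2 (mod 4)`, on the tree's genus fields**: for `d = p₁⋯p_k` odd square-free,
`g(2d) = #2Cl(ℚ(√−2d))` (`genusClassNumber (GenusField (2d))`) is odd iff `det (A + D_z) = 1`.
[cite: Smith2016CongruentDensity, §2 Table 1 row n ≡ 2 (4)] [cite: LiMa2008, Thm. 0.4 (Rédei–Reichardt)] -/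
theorem odd_genusClassNumber_genusField_two_mul_iff_det (hp : ∀ i, (p i).Prime)
    (hodd : ∀ i, Odd (p i)) (hinj : Function.Injective p) :
    Odd (genusClassNumber (GenusField (2 * ∏ i, p i))) ↔ (legendreMatrix p + legendreDiagonal p 2).det = 1 :=
  odd_genusClassNumber_two_mul_iff_det p hp hodd hinj (GenusField (2 * ∏ i, p i))
    (isQuadraticFieldOfSqrt_genusField (Nat.succ_le_of_lt
      (Nat.mul_pos two_pos (Finset.prod_pos fun i _ => (hp i).pos))))

end Genus

end Literature.NumberTheory.EllipticCurves.Smith2016
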